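import Literature.NumberTheory.LFunctions.SiegelAbelSummation
import HarnessLib

/-!
# Finite Abel summation for a non-principal character: windows `∑_{N<n≤M} χ(n) a(n)`,
# partial Dirichlet sums on `Re s > 0`, and the vanishing partial sums at a real zero

Topic `Literature/NumberTheory/LFunctions`. Everything in this file is PROVED (theorems only); it
is the first support file of the elementary proof of Heath-Brown's lemma on the sparsity of the
primes `p` with `χ(p) = 1` under a Siegel zero (`ExceptionalPrimesSparse.lean`,
`Literature.Barriers.Parity.GranvilleMollin2000_heathBrownLemma3`).

For a Dirichlet character `χ ≠ χ₀` mod `q` the partial sums `S(N) = ∑_{n ≤ N} χ(n)` satisfy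
`|S(N)| ≤ q` (Montgomery–Vaughan (4.23); the tree's
`Literature.NumberTheory.LFunctions.DirichletAbel.norm_partialSum_le`). Consequences proved here:

* `norm_sum_Ioc_mul_le` — for `a ≥ 0` non-increasing on `n > N`:
  `‖∑_{N < n ≤ M} χ(n) a(n)‖ ≤ 2q · a(N+1)` (finite Abel summation, MV Thm. 1.3 in finite form);
* `tendsto_sum_Icc_mul_cpow` — `∑_{n ≤ N} χ(n) n^{-s} → L(s, χ)` for `Re s > 0`
  (`Literature.NumberTheory.LFunctions.DirichletAbel.LFunction_eq_abelSum`);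
* `norm_sum_Icc_mul_rpow_le_of_LFunction_eq_zero` — if `L(σ, χ) = 0` for a real `σ > 0`, then
  `‖∑_{n ≤ N} χ(n) n^{-σ}‖ ≤ 2q (N+1)^{-σ}` for every `N` (the partial sums are minus the tails);
* `norm_sum_Icc_div_sub_le` — `‖∑_{n ≤ M} χ(n)/n − ∑_{n ≤ N} χ(n)/n‖ ≤ 2q/(N+1)`;
* real-valued versions for quadratic `χ` (`χ(n) ∈ {0, ±1}`): `abs_sum_Ioc_re_mul_le`,
  `abs_sum_Icc_re_mul_rpow_le_of_LFunction_eq_zero`, `abs_sum_Icc_re_div_sub_le`.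

## References

* H. L. Montgomery, R. C. Vaughan, *Multiplicative Number Theory I*, CUP 2007, §1.3 Thm. 1.3,
  §4.3 (4.20)–(4.23). [MontgomeryVaughan2007]
-/

noncomputable section

open Complex Filter Topology Finset
open Literature.NumberTheory.LFunctions.DirichletAbel

namespace Literature.NumberTheory.LFunctions.SiegelZero

variable {q : ℕ} [NeZero q] (χ : DirichletCharacter ℂ q)

/-! ### Window sums of `χ` -/

omit [NeZero q] in
/-- `S(N) = ∑_{0 < n ≤ N} χ(n)` (the tree's `partialSum` as an `Ioc`-sum). [folklore] -/
theorem partialSum_eq_sum_Ioc (N : ℕ) :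
    partialSum χ N = ∑ n ∈ Ioc 0 N, χ (n : ZMod q) := by
  induction N with
  | zero => simp [partialSum]
  | succ N ih => rw [partialSum_succ, ih, Finset.sum_Ioc_succ_top (Nat.zero_le N)]

/-- **Window sums of a non-principal character are bounded by `2q`**:
`‖∑_{N < n ≤ M} χ(n)‖ ≤ 2q` (difference of two partial sums, each of norm `≤ q`, MV (4.23)).
[cite: MontgomeryVaughan2007, §4.3 eq. (4.23)] -/
theorem norm_sum_Ioc_apply_le (hχ : χ ≠ 1) (N M : ℕ) :
    ‖∑ n ∈ Ioc N M, χ (n : ZMod q)‖ ≤ 2 * q := by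
  rcases le_or_gt N M with h | h
  · have hsplit := Finset.sum_Ioc_consecutive (fun n : ℕ => χ (n : ZMod q)) (Nat.zero_le N) h
    have heq : ∑ n ∈ Ioc N M, χ (n : ZMod q) = partialSum χ M - partialSum χ N := by
      rw [partialSum_eq_sum_Ioc, partialSum_eq_sum_Ioc, ← hsplit]
      ring
    rw [heq]
    calc ‖partialSum χ M - partialSum χ N‖ ≤ ‖partialSum χ M‖ + ‖partialSum χ N‖ :=
          norm_sub_le _ _
      _ ≤ q + q := add_le_add (norm_partialSum_le χ hχ M) (norm_partialSum_le χ hχ N)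
      _ = 2 * q := by ring
  · rw [Finset.Ioc_eq_empty (by omega), Finset.sum_empty, norm_zero]
    positivity

/-! ### Finite Abel summation -/

omit [NeZero q] in
/-- **Abel summation over a window** (MV Thm. 1.3 in finite form): for `N ≤ M` and any `a`,
`∑_{N<n≤M} χ(n) a(n) = S_N(M) a(M+1) + ∑_{N<n≤M} S_N(n) (a(n) − a(n+1))`,
`S_N(n) = ∑_{N<k≤n} χ(k)`. [cite: MontgomeryVaughan2007, §1.3 Thm. 1.3] -/
theorem sum_Ioc_mul_eq_abel (a : ℕ → ℂ) {N M : ℕ} (h : N ≤ M) :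
    ∑ n ∈ Ioc N M, χ (n : ZMod q) * a n =
      (∑ n ∈ Ioc N M, χ (n : ZMod q)) * a (M + 1) +
        ∑ n ∈ Ioc N M, (∑ k ∈ Ioc N n, χ (k : ZMod q)) * (a n - a (n + 1)) := by
  induction M, h using Nat.le_induction with
  | base => simp
  | succ M hNM ih =>
    rw [Finset.sum_Ioc_succ_top hNM, ih, Finset.sum_Ioc_succ_top hNM,
      Finset.sum_Ioc_succ_top hNM, Finset.sum_Ioc_succ_top hNM]
    ring

/-- **The finite Abel bound**: if `a(n) ≥ 0` and `a(n+1) ≤ a(n)` for all `n > N`, then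
`‖∑_{N<n≤M} χ(n) a(n)‖ ≤ 2q · a(N+1)` for a non-principal `χ` mod `q`.
[cite: MontgomeryVaughan2007, §1.3 Thm. 1.3 with §4.3 eq. (4.23)] -/
theorem norm_sum_Ioc_mul_le (hχ : χ ≠ 1) {a : ℕ → ℝ} {N : ℕ}
    (ha0 : ∀ n, N < n → 0 ≤ a n) (ha : ∀ n, N < n → a (n + 1) ≤ a n) (M : ℕ) :
    ‖∑ n ∈ Ioc N M, χ (n : ZMod q) * (a n : ℂ)‖ ≤ 2 * q * a (N + 1) := by
  rcases le_or_gt N M with h | h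
  swap
  · rw [Finset.Ioc_eq_empty (by omega), Finset.sum_empty, norm_zero]
    exact mul_nonneg (by positivity) (ha0 _ (Nat.lt_succ_self N))
  have htel : ∑ n ∈ Ioc N M, (a n - a (n + 1)) = a (N + 1) - a (M + 1) := by
    clear ha0 ha
    induction M, h using Nat.le_induction with
    | base => simp
    | succ M hNM ih => rw [Finset.sum_Ioc_succ_top hNM, ih]; ring
  have key := sum_Ioc_mul_eq_abel χ (fun n => (a n : ℂ)) h
  simp only at key
  rw [key]
  have hS : ∀ n, ‖∑ k ∈ Ioc N n, χ (k : ZMod q)‖ ≤ 2 * q := fun n => norm_sum_Ioc_apply_le χ hχ N n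
  have haM : 0 ≤ a (M + 1) := ha0 _ (by omega)
  calc ‖(∑ n ∈ Ioc N M, χ (n : ZMod q)) * (a (M + 1) : ℂ) +
        ∑ n ∈ Ioc N M, (∑ k ∈ Ioc N n, χ (k : ZMod q)) * ((a n : ℂ) - (a (n + 1) : ℂ))‖
      ≤ ‖(∑ n ∈ Ioc N M, χ (n : ZMod q)) * (a (M + 1) : ℂ)‖ +
        ∑ n ∈ Ioc N M, ‖(∑ k ∈ Ioc N n, χ (k : ZMod q)) * ((a n : ℂ) - (a (n + 1) : ℂ))‖ :=
          (norm_add_le _ _).trans (by gcongr; exact norm_sum_le _ _)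
    _ ≤ 2 * q * a (M + 1) + ∑ n ∈ Ioc N M, 2 * q * (a n - a (n + 1)) := by
        gcongr with n hn
        · rw [norm_mul, Complex.norm_real, Real.norm_of_nonneg haM]
          exact mul_le_mul_of_nonneg_right (hS M) haM
        · have hn' : N < n := (Finset.mem_Ioc.mp hn).1
          have hd : 0 ≤ a n - a (n + 1) := sub_nonneg.mpr (ha n hn')
          rw [norm_mul, ← Complex.ofReal_sub, Complex.norm_real, Real.norm_of_nonneg hd]
          exact mul_le_mul_of_nonneg_right (hS n) hd
    _ = 2 * q * a (N + 1) := by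
        rw [← Finset.mul_sum, htel]
        ring

/-! ### Partial Dirichlet sums on `Re s > 0` -/

omit [NeZero q] in
/-- `∑_{1 ≤ n ≤ N} χ(n) n^{-s}` written as a `range`-sum (the indexing of the tree's
`sum_apply_mul_cpow_eq`). [folklore] -/
theorem sum_Icc_mul_cpow_eq_sum_range (s : ℂ) (N : ℕ) :
    ∑ n ∈ Icc 1 N, χ (n : ZMod q) * (n : ℂ) ^ (-s) =
      ∑ n ∈ range N, χ ((n + 1 : ℕ) : ZMod q) * ((n + 1 : ℕ) : ℂ) ^ (-s) := by
  induction N with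
  | zero => simp
  | succ N ih => rw [Finset.sum_Icc_succ_top (by omega), ih, Finset.sum_range_succ]

/-- **Partial Dirichlet sums converge to `L(s, χ)` on `Re s > 0`** for `χ ≠ χ₀`:
`∑_{n ≤ N} χ(n) n^{-s} → L(s, χ)` (Abel summation: the boundary term `S(N)(N+1)^{-s} → 0` and the
Abel transform converges to `L(s, χ)` by the tree's `LFunction_eq_abelSum`).
[cite: MontgomeryVaughan2007, §4.3 Thm. 4.8; §1.3 Thm. 1.3] -/
theorem tendsto_sum_Icc_mul_cpow (hχ : χ ≠ 1) {s : ℂ} (hs : 0 < s.re) :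
    Tendsto (fun N : ℕ => ∑ n ∈ Icc 1 N, χ (n : ZMod q) * (n : ℂ) ^ (-s)) atTop
      (𝓝 (χ.LFunction s)) := by
  have hfun : (fun N : ℕ => ∑ n ∈ Icc 1 N, χ (n : ZMod q) * (n : ℂ) ^ (-s)) =
      fun N : ℕ => partialSum χ N * ((N + 1 : ℕ) : ℂ) ^ (-s) + ∑ n ∈ range N, term χ n s := by
    funext N
    rw [sum_Icc_mul_cpow_eq_sum_range, sum_apply_mul_cpow_eq]
  rw [hfun]
  -- the boundary term tends to zero
  have hB : Tendsto (fun N : ℕ => partialSum χ N * ((N + 1 : ℕ) : ℂ) ^ (-s)) atTop (𝓝 0) := by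
    refine squeeze_zero_norm (a := fun N : ℕ => q * ((N + 1 : ℕ) : ℝ) ^ (-s.re)) ?_ ?_
    · intro N
      rw [norm_mul, Complex.norm_natCast_cpow_of_pos (Nat.succ_pos N), neg_re]
      exact mul_le_mul_of_nonneg_right (norm_partialSum_le χ hχ N) (by positivity)
    · have h1 : Tendsto (fun N : ℕ => ((N + 1 : ℕ) : ℝ)) atTop atTop :=
        tendsto_natCast_atTop_atTop.comp (tendsto_add_atTop_nat 1)
      have h2 := (tendsto_rpow_neg_atTop (y := s.re) hs).comp h1
      simpa using h2.const_mul (q : ℝ)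
  -- the series tends to the Abel transform, which is `L(s, χ)`
  have hT : Tendsto (fun N => ∑ n ∈ range N, term χ n s) atTop (𝓝 (abelSum χ s)) :=
    (summable_term χ hχ hs).hasSum.tendsto_sum_nat
  have := hB.add hT
  rwa [zero_add, ← LFunction_eq_abelSum χ hχ hs] at this

/-- **At a real zero the partial sums are minus the tails**: if `χ ≠ χ₀`, `σ > 0` and
`L(σ, χ) = 0`, then `‖∑_{n ≤ N} χ(n) n^{-σ}‖ ≤ 2q (N+1)^{-σ}` for every `N`
(`∑_{n ≤ N} = −lim_M ∑_{N < n ≤ M}` and the finite Abel bound). [cite: MontgomeryVaughan2007, §1.3 Thm. 1.3 with §4.3 eq. (4.23)] -/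
theorem norm_sum_Icc_mul_rpow_le_of_LFunction_eq_zero (hχ : χ ≠ 1) {σ : ℝ} (hσ : 0 < σ)
    (h0 : χ.LFunction σ = 0) (N : ℕ) :
    ‖∑ n ∈ Icc 1 N, χ (n : ZMod q) * (((n : ℝ) ^ (-σ) : ℝ) : ℂ)‖ ≤
      2 * q * ((N + 1 : ℕ) : ℝ) ^ (-σ) := by
  set P : ℕ → ℂ := fun M => ∑ n ∈ Icc 1 M, χ (n : ZMod q) * (((n : ℝ) ^ (-σ) : ℝ) : ℂ) with hP
  -- `P(M) → L(σ, χ) = 0`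
  have hlim : Tendsto P atTop (𝓝 0) := by
    have h := tendsto_sum_Icc_mul_cpow χ hχ (s := σ) (by simpa using hσ)
    rw [h0] at h
    refine h.congr fun M => Finset.sum_congr rfl fun n _ => ?_
    rw [Complex.ofReal_cpow (Nat.cast_nonneg n), Complex.ofReal_natCast, Complex.ofReal_neg]
  -- `P(M) = P(N) + window`, the window bounded by `2q (N+1)^{-σ}`
  have hwin : ∀ M, N ≤ M → ‖P N‖ ≤ ‖P M‖ + 2 * q * ((N + 1 : ℕ) : ℝ) ^ (-σ) := by
    intro M hNM
    have hsplit : P M = P N + ∑ n ∈ Ioc N M, χ (n : ZMod q) * (((n : ℝ) ^ (-σ) : ℝ) : ℂ) := by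
      have hI : ∀ K : ℕ, Finset.Icc 1 K = Finset.Ioc 0 K := fun K => by
        ext n; simp only [Finset.mem_Icc, Finset.mem_Ioc]; omega
      simp only [hP]
      rw [hI, hI, ← Finset.sum_Ioc_consecutive _ (Nat.zero_le N) hNM]
    have hW : ‖∑ n ∈ Ioc N M, χ (n : ZMod q) * (((n : ℝ) ^ (-σ) : ℝ) : ℂ)‖ ≤
        2 * q * ((N + 1 : ℕ) : ℝ) ^ (-σ) := by
      have h := norm_sum_Ioc_mul_le χ hχ (a := fun n : ℕ => (n : ℝ) ^ (-σ)) (N := N)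
        (fun n _ => by positivity) (fun n hn => ?_) M
      · simpa using h
      · have hn0 : (0 : ℝ) < n := by exact_mod_cast (Nat.zero_le N).trans_lt hn
        push_cast
        exact Real.rpow_le_rpow_of_nonpos hn0 (by linarith) (by linarith)
    have hPN : P N = P M - ∑ n ∈ Ioc N M, χ (n : ZMod q) * (((n : ℝ) ^ (-σ) : ℝ) : ℂ) := by
      rw [hsplit]; ring
    calc ‖P N‖ = ‖P M - ∑ n ∈ Ioc N M, χ (n : ZMod q) * (((n : ℝ) ^ (-σ) : ℝ) : ℂ)‖ := by
          rw [hPN]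
      _ ≤ ‖P M‖ + ‖∑ n ∈ Ioc N M, χ (n : ZMod q) * (((n : ℝ) ^ (-σ) : ℝ) : ℂ)‖ := norm_sub_le _ _
      _ ≤ ‖P M‖ + 2 * q * ((N + 1 : ℕ) : ℝ) ^ (-σ) := by gcongr
  -- let `M → ∞`
  have hnorm : Tendsto (fun M => ‖P M‖ + 2 * q * ((N + 1 : ℕ) : ℝ) ^ (-σ)) atTop
      (𝓝 (0 + 2 * q * ((N + 1 : ℕ) : ℝ) ^ (-σ))) := by
    have := (tendsto_norm.comp hlim)
    rw [norm_zero] at this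
    exact this.add tendsto_const_nhds
  have := ge_of_tendsto hnorm (Filter.eventually_atTop.mpr ⟨N, hwin⟩)
  simpa using this

/-- **The harmonic partial sums of `χ` are Cauchy with rate `2q/N`**: for `N ≤ M`,
`‖∑_{n ≤ M} χ(n)/n − ∑_{n ≤ N} χ(n)/n‖ ≤ 2q/(N+1)`. [cite: MontgomeryVaughan2007, §1.3 Thm. 1.3 with §4.3 eq. (4.23)] -/
theorem norm_sum_Icc_div_sub_le (hχ : χ ≠ 1) {N M : ℕ} (h : N ≤ M) :
    ‖∑ n ∈ Icc 1 M, χ (n : ZMod q) / n - ∑ n ∈ Icc 1 N, χ (n : ZMod q) / n‖ ≤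
      2 * q / ((N : ℝ) + 1) := by
  have hsplit : ∑ n ∈ Icc 1 M, χ (n : ZMod q) / n - ∑ n ∈ Icc 1 N, χ (n : ZMod q) / n =
      ∑ n ∈ Ioc N M, χ (n : ZMod q) * (((1 : ℝ) / n : ℝ) : ℂ) := by
    have hI : ∀ K : ℕ, Finset.Icc 1 K = Finset.Ioc 0 K := fun K => by
      ext n; simp only [Finset.mem_Icc, Finset.mem_Ioc]; omega
    rw [hI, hI, ← Finset.sum_Ioc_consecutive _ (Nat.zero_le N) h, add_sub_cancel_left]
    refine Finset.sum_congr rfl fun n _ => ?_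
    push_cast
    ring
  rw [hsplit]
  have hb := norm_sum_Ioc_mul_le χ hχ (a := fun n : ℕ => (1 : ℝ) / n) (N := N)
    (fun n _ => by positivity) (fun n hn => ?_) M
  · refine hb.trans (le_of_eq ?_)
    push_cast
    ring
  · have hn0 : (0 : ℝ) < n := by exact_mod_cast (Nat.zero_le N).trans_lt hn
    push_cast
    exact one_div_le_one_div_of_le hn0 (by linarith)

/-! ### Real-valued forms for a quadratic character -/

omit [NeZero q] in
/-- A quadratic character takes real values: `χ(a) = Re χ(a)`. [folklore] -/
theorem apply_eq_ofReal_re (hq : χ ^ 2 = 1) (a : ZMod q) : χ a = (((χ a).re : ℝ) : ℂ) := by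
  apply Complex.ext
  · simp
  · simp [apply_im_eq_zero χ hq a]

omit [NeZero q] in
/-- For a quadratic character and real weights, `∑ χ(n) a(n)` is the real number
`∑ Re χ(n) · a(n)`. [folklore] -/
theorem sum_mul_ofReal_eq (hq : χ ^ 2 = 1) (s : Finset ℕ) (a : ℕ → ℝ) :
    ∑ n ∈ s, χ (n : ZMod q) * (a n : ℂ) = ((∑ n ∈ s, (χ (n : ZMod q)).re * a n : ℝ) : ℂ) := by
  rw [Complex.ofReal_sum]
  refine Finset.sum_congr rfl fun n _ => ?_
  rw [apply_eq_ofReal_re χ hq]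
  push_cast
  simp

/-- **Finite Abel bound, real form**: for a quadratic `χ ≠ χ₀` and `a ≥ 0` non-increasing on
`n > N`, `|∑_{N<n≤M} χ(n) a(n)| ≤ 2q · a(N+1)`. [cite: MontgomeryVaughan2007, §1.3 Thm. 1.3 with §4.3 eq. (4.23)] -/
theorem abs_sum_Ioc_re_mul_le (hχ : χ ≠ 1) (hq : χ ^ 2 = 1) {a : ℕ → ℝ} {N : ℕ}
    (ha0 : ∀ n, N < n → 0 ≤ a n) (ha : ∀ n, N < n → a (n + 1) ≤ a n) (M : ℕ) :
    |∑ n ∈ Ioc N M, (χ (n : ZMod q)).re * a n| ≤ 2 * q * a (N + 1) := by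
  have h := norm_sum_Ioc_mul_le χ hχ ha0 ha M
  rwa [sum_mul_ofReal_eq χ hq, Complex.norm_real, Real.norm_eq_abs] at h

/-- **Vanishing partial sums at a real zero, real form**: for a quadratic `χ ≠ χ₀`, `σ > 0`,
`L(σ, χ) = 0`: `|∑_{n ≤ N} χ(n) n^{-σ}| ≤ 2q (N+1)^{-σ}`. [cite: MontgomeryVaughan2007, §1.3 Thm. 1.3 with §4.3 eq. (4.23)] -/
theorem abs_sum_Icc_re_mul_rpow_le_of_LFunction_eq_zero (hχ : χ ≠ 1) (hq : χ ^ 2 = 1) {σ : ℝ}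
    (hσ : 0 < σ) (h0 : χ.LFunction σ = 0) (N : ℕ) :
    |∑ n ∈ Icc 1 N, (χ (n : ZMod q)).re * (n : ℝ) ^ (-σ)| ≤ 2 * q * ((N + 1 : ℕ) : ℝ) ^ (-σ) := by
  have h := norm_sum_Icc_mul_rpow_le_of_LFunction_eq_zero χ hχ hσ h0 N
  rwa [sum_mul_ofReal_eq χ hq, Complex.norm_real, Real.norm_eq_abs] at h

/-- **Harmonic partial sums, real form**: for a quadratic `χ ≠ χ₀` and `N ≤ M`,
`|∑_{n ≤ M} χ(n)/n − ∑_{n ≤ N} χ(n)/n| ≤ 2q/(N+1)`. [cite: MontgomeryVaughan2007, §1.3 Thm. 1.3 with §4.3 eq. (4.23)] -/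
theorem abs_sum_Icc_re_div_sub_le (hχ : χ ≠ 1) (hq : χ ^ 2 = 1) {N M : ℕ} (h : N ≤ M) :
    |∑ n ∈ Icc 1 M, (χ (n : ZMod q)).re / n - ∑ n ∈ Icc 1 N, (χ (n : ZMod q)).re / n| ≤
      2 * q / ((N : ℝ) + 1) := by
  have h' := norm_sum_Icc_div_sub_le χ hχ h
  have e : ∀ K : ℕ, ∑ n ∈ Icc 1 K, χ (n : ZMod q) / n =
      ((∑ n ∈ Icc 1 K, (χ (n : ZMod q)).re / n : ℝ) : ℂ) := by
    intro K
    have := sum_mul_ofReal_eq χ hq (Icc 1 K) (fun n => 1 / (n : ℝ))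
    simp only [one_div] at this
    rw [Complex.ofReal_sum]
    rw [Complex.ofReal_sum] at this
    refine (Finset.sum_congr rfl fun n _ => ?_).trans (this.trans (Finset.sum_congr rfl fun n _ => ?_))
    · push_cast; ring
    · push_cast; ring
  rwa [e M, e N, ← Complex.ofReal_sub, Complex.norm_real, Real.norm_eq_abs] at h'

end Literature.NumberTheory.LFunctions.SiegelZero

end
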